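import Summits.ResolutionOfSingularities.ResolutionOfSingularities.Theorems.PurelyInseparableDim4IsolationCert
import Summits.ResolutionOfSingularities.ResolutionOfSingularities.Theorems.PurelyInseparableDim4TrapBaseChange
import Summits.ResolutionOfSingularities.ResolutionOfSingularities.Theorems.PurelyInseparableDim4FrameTraps
import Literature.RingTheory.MvPolynomial.IdealOfVarsBasics
import Mathlib.RingTheory.Localization.AtPrime.Basic
import Mathlib.RingTheory.Localization.Ideal
import Mathlib.RingTheory.Localization.Submodule
import Mathlib.RingTheory.Ideal.MinimalPrime.Basic
import Mathlib.RingTheory.Finiteness.Ideal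
import HarnessLib
import HarnessLib.Audit.Tags

/-!
# Purely inseparable fourfolds — ISOLATION IS THE CERTIFICATE, and it goes UP under extension of the field
# [OURS · counted 0 · commutative algebra about OUR frame's isolation predicate, not about resolution]

Census cell «res-dim4-pi» (D-0157 DOOR 2), width seat `res-dim4-p-14`, brick PR-12f; companion of
p-3's PR-10 (`PurelyInseparableDim4IsolationCert`: certificate ⇒ isolated) and of PR-12b/PR-12d
(`…TrapBaseChange`, `…FrameTraps`).  For the Scope add-on's `IsIsolated q F` («the origin is an isolated
`q`-fold point»: `J_q⁺(F) ≤ 𝔪₀` and every minimal prime of `J_q⁺(F)` inside `𝔪₀` is `𝔪₀`):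

* §1 **`exists_certificate_of_isIsolated` — THE CONVERSE OF PR-10**: `IsIsolated q F →
  ∃ N, 𝔪₀ᴺ ≤ J_q⁺(F) + 𝔪₀ᴺ⁺¹`.  Proof: localise `A = K[x₁..x₄]` at `𝔪₀`; a prime of `A_𝔪₀` over
  `J·A_𝔪₀` contracts to a prime `P` with `J ≤ P ≤ 𝔪₀`, which contains a minimal prime of `J` inside `𝔪₀`
  (`Ideal.exists_minimalPrimes_le`), i.e. `𝔪₀` itself; so `rad(J·A_𝔪₀) ⊇` the maximal ideal, and
  (Noetherian) some power `(𝔪₀ A_𝔪₀)ᴺ ≤ J·A_𝔪₀` (`Ideal.exists_pow_le_of_le_radical_of_fg`); pulling back,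
  every degree-`N` monomial `x^γ` has `t·x^γ ∈ J` for some `t` with `t(0) ≠ 0`, whence
  `x^γ ∈ J + 𝔪₀ᴺ⁺¹` and p-3's monomial form of the certificate closes.  Hence
  **`isIsolated_iff_exists_certificate`**: idea-3's `𝔽_p`-linear-algebra instrument is COMPLETE — every
  isolated state HAS a finite certificate (an «undecided» verdict only means `N` was too small).
* §2 **isolation goes UP** along any homomorphism of fields `f : k →+* K`: `hasseDeriv_map`,
  `singLocusIdeal_map` (`J_q⁺(F ⊗ K) = J_q⁺(F)·K[x]`), `originIdeal_map`, and **`isIsolated_map`**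
  (`IsIsolated q F → IsIsolated q (F ⊗ K)`, by transporting the certificate).
* §3 with PR-12b (`BaseChange.edge_map`): `Step0` edges go up (`step0_map`), so an ISOLATED
  SELF-SUSTAINING SET (PR-12d's kill shape for F4-I `NoIsolatedTrap`) over `k` maps to one over `K`
  (`isolatedTrap_image`); over `𝔽_p` it reaches EVERY field of characteristic `p`
  (`forall_exists_isolatedTrap_of_zmod`) — F4-I kill certificates over the prime field are universal, like
  `IsTrap` ones (`not_noIsolatedTrap_of_isolatedTrap`).

NOT here (flagged): descent of the certificate from `K` to `k` (true by a `k`-linear retraction; not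
needed for «traps go up»).  Nothing here proves resolution of singularities in dimension ≥ 4 /
characteristic `p`; counted 0; AI work, weaker than expert review.
bears_on: LADDER-RESOLUTION:D157-DOOR2 (res-dim4-pi · PR-12f). Supports stmt-ResolutionOfSingularities-16155
(helper).
-/

set_option linter.dupNamespace false

noncomputable section

namespace Summit.ResolutionOfSingularities.ResolutionOfSingularities.Theorems.PIDim4

namespace IsolationConverse

open MvPolynomial
open Literature.AlgebraicGeometry.Resolution
open Literature.RingTheory.MvPolynomial (isPrime_idealOfVars mem_idealOfVars_iff_constantCoeff_eq_zero
  sub_C_constantCoeff_mem_idealOfVars monomial_mem_idealOfVars_pow_of_le)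

/-! ## 1. Isolated ⇒ certificate (the converse of PR-10) -/

/-- `𝔪₀` is prime. [folklore] -/
theorem isPrime_originIdeal (K : Type) [Field K] : (originIdeal K).IsPrime := by
  rw [IsolationCert.originIdeal_eq_idealOfVars]
  exact isPrime_idealOfVars

/-- An element of `K[x₁..x₄]` outside `𝔪₀` (non-zero constant term) times `x^γ`, `|γ| = N`, in `J`
puts `x^γ` in `J + 𝔪₀ᴺ⁺¹`. [folklore] -/
theorem monomial_mem_sup_of_mul_mem {K : Type} [Field K] {J : Ideal (MvPolynomial (Fin 4) K)} {N : ℕ}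
    {γ : Fin 4 →₀ ℕ} (hγ : γ.degree = N) {t : MvPolynomial (Fin 4) K} (ht : t ∉ originIdeal K)
    (htJ : t * monomial γ 1 ∈ J) : monomial γ (1 : K) ∈ J ⊔ originIdeal K ^ (N + 1) := by
  rw [IsolationCert.originIdeal_eq_idealOfVars] at ht ⊢
  rw [mem_idealOfVars_iff_constantCoeff_eq_zero] at ht
  set c := constantCoeff t with hc
  have hγm : (monomial γ (1 : K)) ∈ MvPolynomial.idealOfVars (Fin 4) K ^ N :=
    monomial_mem_idealOfVars_pow_of_le (le_of_eq hγ.symm) 1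
  have ht' : (t - C c) * monomial γ 1 ∈ MvPolynomial.idealOfVars (Fin 4) K ^ (N + 1) := by
    rw [pow_succ']
    exact Ideal.mul_mem_mul (sub_C_constantCoeff_mem_idealOfVars t) hγm
  have key : monomial γ (1 : K) = C c⁻¹ * (t * monomial γ 1 - (t - C c) * monomial γ 1) := by
    have : t * monomial γ 1 - (t - C c) * monomial γ 1 = C c * monomial γ 1 := by ring
    rw [this, ← mul_assoc, ← C_mul, inv_mul_cancel₀ ht, C_1, one_mul]
  rw [key]
  exact Ideal.mul_mem_left _ _ (Submodule.sub_mem _ (Submodule.mem_sup_left htJ)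
    (Submodule.mem_sup_right ht'))

/-- **THE CONVERSE OF THE ISOLATION CERTIFICATE LEMMA.**  If the origin is an isolated `q`-fold point
(`IsIsolated q F`), then `𝔪₀ᴺ ≤ J_q⁺(F) + 𝔪₀ᴺ⁺¹` for some `N` — the certificate of PR-10 always exists.
Localisation at `𝔪₀`, `rad(J_𝔪₀) ⊇ 𝔪₀A_𝔪₀` from the minimal-prime clause, a Noetherian power, and
pull-back along `A → A_𝔪₀`. [cite: AtiyahMacdonald1969, Prop. 4.8 / Cor. 7.16 (primary components at an isolated prime via localisation)] [folklore] -/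
theorem exists_certificate_of_isIsolated {K : Type} [Field K] {q : ℕ} {F : MvPolynomial (Fin 4) K}
    (h : IsIsolated q F) :
    ∃ N : ℕ, originIdeal K ^ N ≤ singLocusIdeal q F ⊔ originIdeal K ^ (N + 1) := by
  classical
  obtain ⟨-, hmin⟩ := h
  haveI hm : (originIdeal K).IsPrime := isPrime_originIdeal K
  -- the localisation of `A = K[x₁..x₄]` at `𝔪₀`
  let S : Type := Localization.AtPrime (originIdeal K)
  -- every prime of `S` over `J·S` is the maximal ideal, so the maximal ideal lies in `rad(J·S)`
  have hrad : IsLocalRing.maximalIdeal S ≤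
      ((singLocusIdeal q F).map (algebraMap (MvPolynomial (Fin 4) K) S)).radical := by
    rw [Ideal.radical_eq_sInf]
    refine le_sInf ?_
    rintro Q ⟨hJQ, hQ⟩
    obtain ⟨hP, hdisj⟩ :=
      (IsLocalization.isPrime_iff_isPrime_disjoint (originIdeal K).primeCompl S Q).mp hQ
    haveI := hP
    have hJP : singLocusIdeal q F ≤ Q.under (MvPolynomial (Fin 4) K) := by
      rw [Ideal.under_def, ← Ideal.map_le_iff_le_comap]
      exact hJQ
    have hPm : Q.under (MvPolynomial (Fin 4) K) ≤ originIdeal K := fun x hx => by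
      by_contra hxm
      exact Set.disjoint_left.mp hdisj (Ideal.mem_primeCompl_iff.mpr hxm) hx
    obtain ⟨P₀, hP₀, hP₀P⟩ := Ideal.exists_minimalPrimes_le hJP
    have hmP : originIdeal K ≤ Q.under (MvPolynomial (Fin 4) K) :=
      (hmin P₀ hP₀ (hP₀P.trans hPm)).ge.trans hP₀P
    calc IsLocalRing.maximalIdeal S
        = (originIdeal K).map (algebraMap (MvPolynomial (Fin 4) K) S) :=
          Localization.AtPrime.map_eq_maximalIdeal.symm
      _ ≤ (Q.under (MvPolynomial (Fin 4) K)).map (algebraMap (MvPolynomial (Fin 4) K) S) :=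
          Ideal.map_mono hmP
      _ ≤ Q := Ideal.map_comap_le
  -- a power of the (finitely generated) maximal ideal lies in `J·S`
  obtain ⟨N, hN⟩ := Ideal.exists_pow_le_of_le_radical_of_fg hrad (IsNoetherian.noetherian _)
  refine ⟨N, IsolationCert.pow_le_sup_pow_succ_of_forall_monomial fun γ hγ => ?_⟩
  -- pull the degree-`N` monomial back
  have hγm : (monomial γ (1 : K)) ∈ originIdeal K ^ N := by
    rw [IsolationCert.originIdeal_eq_idealOfVars]
    exact monomial_mem_idealOfVars_pow_of_le (le_of_eq hγ.symm) 1
  have himg : algebraMap (MvPolynomial (Fin 4) K) S (monomial γ 1) ∈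
      (singLocusIdeal q F).map (algebraMap (MvPolynomial (Fin 4) K) S) := by
    apply hN
    have hx : algebraMap (MvPolynomial (Fin 4) K) S (monomial γ 1) ∈
        (originIdeal K ^ N).map (algebraMap (MvPolynomial (Fin 4) K) S) := Ideal.mem_map_of_mem _ hγm
    rwa [Ideal.map_pow, Localization.AtPrime.map_eq_maximalIdeal] at hx
  obtain ⟨⟨⟨a, ha⟩, ⟨s, hs⟩⟩, hx⟩ :=
    (IsLocalization.mem_map_algebraMap_iff (originIdeal K).primeCompl S).mp himg
  dsimp only at hx
  rw [← map_mul] at hx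
  obtain ⟨⟨c, hc⟩, hcx⟩ := (IsLocalization.eq_iff_exists (originIdeal K).primeCompl S).mp hx
  dsimp only at hcx
  have htm : c * s ∉ originIdeal K :=
    Ideal.mem_primeCompl_iff.mp ((originIdeal K).primeCompl.mul_mem hc hs)
  have htJ : (c * s) * monomial γ 1 ∈ singLocusIdeal q F := by
    have : (c * s) * monomial γ 1 = c * a := by rw [← hcx]; ring
    rw [this]
    exact Ideal.mul_mem_left _ c ha
  exact monomial_mem_sup_of_mul_mem hγ htm htJ

/-- **Isolation ⟺ certificate.** [folklore] -/
theorem isIsolated_iff_exists_certificate {K : Type} [Field K] {q : ℕ} {F : MvPolynomial (Fin 4) K} :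
    IsIsolated q F ↔ singLocusIdeal q F ≤ originIdeal K ∧
      ∃ N : ℕ, originIdeal K ^ N ≤ singLocusIdeal q F ⊔ originIdeal K ^ (N + 1) :=
  ⟨fun h => ⟨h.1, exists_certificate_of_isIsolated h⟩,
    fun ⟨hJ, _, hN⟩ => IsolationCert.isIsolated_of_pow_le_sup_pow_succ hJ hN⟩

/-! ## 2. Isolation goes up under extension of the field -/

section BaseChange

variable {k K : Type} [Field k] [Field K] (f : k →+* K)

/-- The frame's Hasse derivative commutes with the coefficient map. [cite: Giraud1975, §1 (Hasse–Schmidt derivations)] [folklore] -/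
theorem hasseDeriv_map (α : Fin 4 →₀ ℕ) (F : MvPolynomial (Fin 4) k) :
    hasseDeriv α (MvPolynomial.map f F) = MvPolynomial.map f (hasseDeriv α F) := by
  unfold hasseDeriv
  rw [map_sum, MvPolynomial.support_map_of_injective F f.injective]
  refine Finset.sum_congr rfl fun d _ => ?_
  rw [MvPolynomial.map_monomial, MvPolynomial.coeff_map]
  congr 1
  rw [f.map_mul, map_prod f]
  simp only [map_natCast]

/-- `J_q⁺(F ⊗ K) = J_q⁺(F) · K[x]`. [folklore] -/
theorem singLocusIdeal_map (q : ℕ) (F : MvPolynomial (Fin 4) k) :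
    singLocusIdeal q (MvPolynomial.map f F) = (singLocusIdeal q F).map (MvPolynomial.map f) := by
  unfold singLocusIdeal
  rw [Ideal.map_span]
  congr 1
  ext G
  constructor
  · rintro ⟨α, h0, hq, rfl⟩
    exact ⟨hasseDeriv α F, ⟨α, h0, hq, rfl⟩, (hasseDeriv_map f α F).symm⟩
  · rintro ⟨_, ⟨α, h0, hq, rfl⟩, rfl⟩
    exact ⟨α, h0, hq, (hasseDeriv_map f α F).symm⟩

omit [Field K] in
/-- `𝔪₀(k) · K[x] = 𝔪₀(K)`. [folklore] -/
theorem originIdeal_map {K : Type} [Field K] (f : k →+* K) :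
    (originIdeal k).map (MvPolynomial.map f) = originIdeal K := by
  rw [IsolationCert.originIdeal_eq_idealOfVars, IsolationCert.originIdeal_eq_idealOfVars,
    MvPolynomial.idealOfVars, MvPolynomial.idealOfVars, Ideal.map_span, ← Set.range_comp]
  congr 2
  funext i
  exact MvPolynomial.map_X f i

/-- **Isolation goes UP**: an isolated `q`-fold point stays isolated after extension of the coefficient
field (transport of the certificate). [folklore] -/
theorem isIsolated_map {q : ℕ} {F : MvPolynomial (Fin 4) k} (h : IsIsolated q F) :
    IsIsolated q (MvPolynomial.map f F) := by
  obtain ⟨N, hN⟩ := exists_certificate_of_isIsolated h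
  refine IsolationCert.isIsolated_of_pow_le_sup_pow_succ ?_ (N := N) ?_
  · rw [singLocusIdeal_map, ← originIdeal_map f]
    exact Ideal.map_mono h.1
  · have h' := Ideal.map_mono (f := MvPolynomial.map f) hN
    rwa [Ideal.map_sup, Ideal.map_pow, Ideal.map_pow, originIdeal_map, ← singLocusIdeal_map] at h'

/-! ## 3. Isolated self-sustaining sets go up -/

variable [DecidableEq k] [DecidableEq K]

/-- `Step0` edges (point blow-up) go up under the coefficient map. [folklore] -/
theorem step0_map {q : ℕ} {s s' : State k} (h : Step0 q s s') :
    Step0 q (⟨MvPolynomial.map f s.F, s.r, s.exc⟩ : State K) ⟨MvPolynomial.map f s'.F, s'.r, s'.exc⟩ :=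
  ⟨by rw [BaseChange.ordAlong_map]; exact h.1, BaseChange.edge_map f h.2⟩

/-- **Isolated self-sustaining sets go up**: the image of a set of isolated states, each with a
`Step0`-successor in the set, is again such a set over the bigger field. [folklore] -/
theorem isolatedTrap_image {q : ℕ} {T : Set (State k)}
    (hT : ∀ s ∈ T, IsIsolated q s.F ∧ ∃ s' ∈ T, Step0 q s s') :
    ∀ s ∈ (fun s : State k => (⟨MvPolynomial.map f s.F, s.r, s.exc⟩ : State K)) '' T,
      IsIsolated q s.F ∧
        ∃ s' ∈ (fun s : State k => (⟨MvPolynomial.map f s.F, s.r, s.exc⟩ : State K)) '' T,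
          Step0 q s s' := by
  rintro _ ⟨s, hs, rfl⟩
  obtain ⟨hiso, s', hs', hstep⟩ := hT s hs
  exact ⟨isIsolated_map f hiso, _, ⟨s', hs', rfl⟩, step0_map f hstep⟩

end BaseChange

/-- **F4-I kill certificates over `𝔽_p` are universal**: a nonempty isolated self-sustaining set over
`ZMod p` yields one over EVERY field of characteristic `p`. [folklore] -/
theorem forall_exists_isolatedTrap_of_zmod (p q : ℕ) [Fact p.Prime] {T : Set (State (ZMod p))}
    (hne : T.Nonempty) (hT : ∀ s ∈ T, IsIsolated q s.F ∧ ∃ s' ∈ T, Step0 q s s')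
    (K : Type) [Field K] [CharP K p] [DecidableEq K] :
    ∃ T' : Set (State K), T'.Nonempty ∧ ∀ s ∈ T', IsIsolated q s.F ∧ ∃ s' ∈ T', Step0 q s s' :=
  ⟨_, hne.image _, isolatedTrap_image (ZMod.castHom (dvd_refl p) K) hT⟩

/-- … and (one field suffices for this) refutes F4-I `NoIsolatedTrap p q` (PR-12d's kill shape).
[folklore] -/
theorem not_noIsolatedTrap_of_isolatedTrap {p q : ℕ} {K : Type} [Field K] [CharP K p] [DecidableEq K]
    {T : Set (State K)} (hne : T.Nonempty) (hT : ∀ s ∈ T, IsIsolated q s.F ∧ ∃ s' ∈ T, Step0 q s s') :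
    ¬ NoIsolatedTrap p q :=
  (FrameTraps.not_noIsolatedTrap_iff_exists_isolatedTrap p q).mpr ⟨K, ‹_›, ‹_›, ‹_›, T, hne, hT⟩

end IsolationConverse

end Summit.ResolutionOfSingularities.ResolutionOfSingularities.Theorems.PIDim4

end
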